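import Literature.Analysis.Fourier.VaalerDualKernel
import Literature.NumberTheory.LFunctions.DirichletLOneTail
import Literature.NumberTheory.LFunctions.DirichletLOneHalfLogBoundEven
import Mathlib.Analysis.Normed.Group.Tannery
import HarnessLib

/-!
# Ramaré's approximate formula for `L(1,χ)` with Vaaler's smoothing (even characters) and
# Corollary 1: `|L(1,χ)| ≤ ½ log q` for even primitive `χ`

Everything in this file is PROVED (theorems only; standard axioms).  Main result:

* `Ramare2001.norm_LFunction_one_le_half_log_of_even` — **Ramaré 2001, Corollary 1 (even part)**:
  for every even primitive Dirichlet character `χ ≠ 1` mod `q`, `‖L(1,χ)‖ ≤ ½ log q`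
  (`ramare2001_corollary1_even` is the same statement in the quantified shape of the even conjunct
  of the named fact `Literature.NumberTheory.LFunctions.ramare2001_corollary1` in
  `ExplicitLOneUpperBounds.lean`).

Road (Ramaré, Acta Arith. 100 (2001), §§IV–VI, with `F = F₃ =` Vaaler's `H = B − K`):

1. `summable_smoothedLSeries`, `tendsto_smoothedLSeries`: the smoothed series
   `A(δ) = Σ_{n≥1} χ(n)(1 − H(δn))/n` converges absolutely (`0 ≤ 1 − H(x) ≤ sinc²(πx)`) and tends
   to `L(1,χ)` as `δ → 0⁺` (Abel summation against the tail bound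
   `|Σ_{n≤N} χ(n)/n − L(1,χ)| ≤ 2q/(N+1)` of `DirichletLOneTail`, and Tannery's theorem).
2. `hasDerivAt_smoothedLSeries`: `A'(δ) = −Σ χ(n) W(δn)` with `W = H'` (Vaaler's Theorem 6,
   `VaalerFunctionIntegralRepresentation`).
3. `tsum_char_mul_vaalerW_eq`: twisted Poisson summation (`CompactFourierPoissonTwist`) —
   `Σ_{n≥1} χ(n)W(δn) = (δq)⁻¹ τ(χ) Σ_{m ≤ q} χ̄(m) G(m/(δq))`, `G = 𝓕W = 2φ` on `[−1,1]`.
4. `hasDerivAt_dualSum`: the dual sum `T(δ) = (τ(χ)/q) Σ_{m ≤ q} χ̄(m) J(m/(δq))`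
   (`J(y) = 2∫_y^1 φ(u)du/u`, `VaalerDualKernel`) has `T' = −A'`.
5. `LFunction_one_eq_smoothed_add_dual` — **Proposition 2 (even χ)**:
   `L(1,χ) = A(δ) + T(δ)` for `0 < δ < 1` (`A + T` is constant on `(0,1)`, `T = 0` near `0`,
   `A → L(1,χ)`).  Ramaré prints `−τ(χ)/q` (a sign typo recorded in his 2004 sequel); only
   `|τ(χ)|/q = q^{-1/2}` is used below.
6. `norm_LFunction_one_le_half_log_of_log_ge`: for `log q ≥ 10`, with `δ = q^{-1/2}`, Lemma 16
   (`Σ(1 − H(δn))/n = −log δ − 1 + δ`, `VaalerWeightPoissonSums`) and the dual-sum bound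
   `Σ_m J(m/√q) ≤ √q − ½ log q + (5 − log π)` (`VaalerDualKernel.sum_vaalerJ_le`) give
   `‖L(1,χ)‖ ≤ ½ log q − (½ log q − 6 + log π)/√q ≤ ½ log q`.
7. `norm_LFunction_one_le_half_log_of_le`: for `q ≤ 25000` the bound follows from Louboutin's
   `‖L(1,χ)‖ ≤ ½ log q + µ − (½ log q − µ)/√q`, `µ < 0.0231`
   (`DirichletLOneHalfLogBoundEven`), since `(√q + 1)µ ≤ ½ log q` on `2 ≤ q ≤ 25000`.

Deviations from print: Ramaré proves Corollary 1 for all `q` from (6.4) with the constant of his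
§VI (see the docstring of `VaalerDualKernel` for the sign slip there); we use the cruder dual constant
`5 − log π` for `log q ≥ 10` and Louboutin's theorem below.  The odd-character half of Corollary 1
(`+ (5/2 − log 6)`, via Proposition 1 / Lemma 17) is not treated here.

## References

* O. Ramaré, *Approximate formulae for L(1,χ)*, Acta Arith. 100 (2001) 245–266: Thm. 1 p. 246,
  Prop. 2 and Cor. 1 p. 247, Lemma 11 p. 256, Lemmas 15–16 p. 259, §VI p. 262.
  [cite: Ramare2001LOneApproximateFormulae, Cor. 1]
* S. Louboutin, *Explicit upper bounds for |L(1,χ)| for primitive characters χ*, Canad. J. Math.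
  53 (2001) 1194–1222, Thm 7 (15). [cite: Louboutin2001CJM, Thm 7 (15) p. 1197]
* J. D. Vaaler, *Some extremal functions in Fourier analysis*, Bull. AMS 12 (1985) 183–216,
  Theorem 6. [cite: Vaaler1985, Thm. 6]
-/

noncomputable section

open Real Filter Topology Set MeasureTheory intervalIntegral Finset
open Literature.Analysis.Fourier

namespace Literature.NumberTheory.LFunctions.Ramare2001

variable {q : ℕ} [NeZero q] (χ : DirichletCharacter ℂ q)

/-! ## Auxiliary facts on `H(x) = B(x) − sinc²(πx)` -/

section Aux

/-- `H(0) = 0`. [cite: Vaaler1985, Thm. 6] -/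
theorem vaalerH_zero : beurlingReal 0 - Real.sinc (π * 0) ^ 2 = 0 := by
  rw [beurlingReal_sub_sinc_sq]; simp

/-- `H` is continuous. [cite: Vaaler1985, Thm. 6] -/
theorem continuous_vaalerH : Continuous fun x : ℝ => beurlingReal x - Real.sinc (π * x) ^ 2 :=
  continuous_iff_continuousAt.2 fun x => (hasDerivAt_beurlingReal_sub_sinc_sq x).continuousAt

/-- Mean value bound: `|H(b) − H(a)| ≤ (b − a)·10e^{2π}/(1 + a²)` for `0 ≤ a ≤ b` (from `H' = W`,
`|W(x)| ≤ 10e^{2π}/(1+x²)`). [cite: Vaaler1985, Thm. 6] -/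
theorem abs_vaalerH_sub_le {a b : ℝ} (ha : 0 ≤ a) (hab : a ≤ b) :
    |(beurlingReal b - Real.sinc (π * b) ^ 2) - (beurlingReal a - Real.sinc (π * a) ^ 2)|
      ≤ 10 * Real.exp (2 * π) / (1 + a ^ 2) * (b - a) := by
  have hbound : ∀ x ∈ Icc a b, ‖4 * ∫ t in (0:ℝ)..1,
      (t + π * t * (1 - t) * (Real.cos (π * t) / Real.sin (π * t))) * Real.cos (2 * π * x * t)‖
        ≤ 10 * Real.exp (2 * π) / (1 + a ^ 2) := by
    intro x hx
    rw [Real.norm_eq_abs]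
    refine (abs_vaalerW_le_div_one_add_sq x).trans ?_
    apply div_le_div_of_nonneg_left (by positivity) (by positivity)
    nlinarith [hx.1]
  have h := Convex.norm_image_sub_le_of_norm_hasDerivWithin_le
    (f := fun x : ℝ => beurlingReal x - Real.sinc (π * x) ^ 2)
    (fun x _ => (hasDerivAt_beurlingReal_sub_sinc_sq x).hasDerivWithinAt) hbound
    (convex_Icc a b) (left_mem_Icc.2 hab) (right_mem_Icc.2 hab)
  rw [Real.norm_eq_abs, Real.norm_eq_abs, abs_of_nonneg (sub_nonneg.2 hab)] at h
  exact h

/-- For an even integrable-decay `f : ℤ → ℂ` with `f(0) = 0`: `Σ_ℤ f = 2 Σ_{n ≥ 1} f(n)`. [folklore] -/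
private theorem tsum_int_eq_two_mul_tsum_nat {f : ℤ → ℂ} (hf : Summable f)
    (heven : ∀ n : ℤ, f (-n) = f n) (h0 : f 0 = 0) :
    ∑' n : ℤ, f n = 2 * ∑' n : ℕ, f ((n : ℤ) + 1) := by
  obtain ⟨S, hS⟩ := hf.comp_injective Nat.cast_injective
  have hS' : HasSum (fun n : ℕ => f n) S := hS
  have h1 : HasSum (fun n : ℕ => f ((n : ℤ) + 1)) (S - f 0) := by
    have := (hasSum_nat_add_iff' 1).2 hS'
    simpa [Nat.cast_succ] using this
  have h2 : HasSum (fun n : ℕ => f (-((n : ℤ) + 1))) (S - f 0) :=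
    h1.congr_fun fun n => by rw [heven]
  have h3 := HasSum.of_nat_of_neg_add_one hS' h2
  rw [h3.tsum_eq, h1.tsum_eq, h0]; ring

variable {Φ G : ℝ → ℝ}

/-- `G(y) = 2Φ(min(y,1))` for `y ≥ 0`. [cite: Vaaler1985, Thm. 6] -/
theorem vaalerG_eq_two_mul_min
    (hΦ : Φ = fun u => Real.cos (π * u) / (Real.sinc (π * u) + Real.sinc (π * (1 - u))) + u)
    (hG : G = fun y => if |y| ≤ 1 then 2 * Φ |y| else 0) {y : ℝ} (hy : 0 ≤ y) :
    G y = 2 * Φ (min y 1) := by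
  rcases le_or_gt y 1 with h | h
  · rw [hG]; simp only [abs_of_nonneg hy, if_pos h, min_eq_left h]
  · rw [vaalerG_eq_zero hΦ hG (by rw [abs_of_nonneg hy]; exact h.le), min_eq_right h.le,
      (vaalerPhi_zero_one hΦ).2, mul_zero]

end Aux

/-! ## The smoothed series `A(δ) = Σ χ(n)(1 − H(δn))/n`: summability, limit `δ → 0⁺`, derivative -/

section Smoothed

omit [NeZero q] in
/-- The smoothed series converges absolutely for `0 < δ ≤ 1`.
[cite: Ramare2001LOneApproximateFormulae, Thm. 1 p. 246] -/
theorem summable_smoothedLSeries {δ : ℝ} (hδ : 0 < δ) (hδ1 : δ ≤ 1) :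
    Summable fun n : ℕ => χ ((n + 1 : ℕ) : ZMod q) *
      (((1 - (beurlingReal (δ * (n + 1)) - Real.sinc (π * (δ * (n + 1))) ^ 2)) / (n + 1) : ℝ) : ℂ) := by
  refine Summable.of_norm_bounded (g := fun n : ℕ =>
    (1 - (beurlingReal (δ * (n + 1)) - Real.sinc (π * (δ * (n + 1))) ^ 2)) / (n + 1))
    (hasSum_one_sub_vaalerH_div hδ hδ1).summable fun n => ?_
  rw [norm_mul, Complex.norm_real, Real.norm_eq_abs,
    abs_of_nonneg (div_nonneg (one_sub_beurlingReal_sub_sinc_sq_nonneg (by positivity)) (by positivity))]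
  exact mul_le_of_le_one_left (div_nonneg (one_sub_beurlingReal_sub_sinc_sq_nonneg (by positivity))
    (by positivity)) (χ.norm_le_one _)

/-- **`A(δ) → L(1,χ)` as `δ → 0⁺`** (Abel summation against the tail `Σ_{n>N} χ(n)/n = O(q/N)` and
Tannery's theorem; the weights `1 − H(δn)` lie in `[0,1]`, tend to `1`, and have increments
`≪ δ/(1 + δ²n²)`). [cite: Ramare2001LOneApproximateFormulae, Thm. 1 p. 246 (proof, §IV)] -/
theorem tendsto_smoothedLSeries (hχ1 : χ ≠ 1) :
    Tendsto (fun δ : ℝ => ∑' n : ℕ, χ ((n + 1 : ℕ) : ZMod q) *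
      (((1 - (beurlingReal (δ * (n + 1)) - Real.sinc (π * (δ * (n + 1))) ^ 2)) / (n + 1) : ℝ) : ℂ))
      (𝓝[>] 0) (𝓝 (χ.LFunction 1)) := by
  set C : ℝ := 10 * Real.exp (2 * π) with hC
  set L := χ.LFunction 1 with hL
  set a : ℕ → ℂ := fun n => χ ((n + 1 : ℕ) : ZMod q) / ((n : ℂ) + 1) with ha
  set Rt : ℕ → ℂ := fun N => L - ∑ n ∈ Finset.range N, a n with hRt
  have hRt_le : ∀ N, ‖Rt N‖ ≤ 2 * q / ((N : ℝ) + 1) := by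
    intro N
    rw [hRt, norm_sub_rev]
    exact DirichletAbel.norm_sum_div_sub_LFunction_one_le_level χ hχ1 N
  have hRt0 : Rt 0 = L := by simp [hRt]
  have hRa : ∀ n, a n = Rt n - Rt (n + 1) := by
    intro n; simp only [hRt, Finset.sum_range_succ]; ring
  set w : ℕ → ℝ → ℝ := fun n δ =>
    1 - (beurlingReal (δ * (n + 1)) - Real.sinc (π * (δ * (n + 1))) ^ 2) with hw
  have hterm : ∀ (n : ℕ) (δ : ℝ), χ ((n + 1 : ℕ) : ZMod q) *
      (((1 - (beurlingReal (δ * (n + 1)) - Real.sinc (π * (δ * (n + 1))) ^ 2)) / (n + 1) : ℝ) : ℂ)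
        = a n * (w n δ : ℂ) := by
    intro n δ; simp only [ha, hw]; push_cast; ring
  -- Abel summation (finite form)
  have habel : ∀ (δ : ℝ) (N : ℕ), ∑ n ∈ Finset.range N, a n * (w n δ : ℂ)
      = Rt 0 * (w 0 δ : ℂ) - Rt N * (w N δ : ℂ)
        + ∑ n ∈ Finset.range N, Rt (n + 1) * ((w (n + 1) δ : ℂ) - w n δ) := by
    intro δ N
    induction N with
    | zero => simp
    | succ N ih => rw [Finset.sum_range_succ, Finset.sum_range_succ, ih, hRa]; ring
  -- the weights
  have hw_nonneg : ∀ (n : ℕ) {δ : ℝ}, 0 < δ → 0 ≤ w n δ := fun n δ hδ =>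
    one_sub_beurlingReal_sub_sinc_sq_nonneg (by positivity)
  have hw_le_one : ∀ (n : ℕ) {δ : ℝ}, 0 < δ → w n δ ≤ 1 := fun n δ hδ => by
    have h1 := one_sub_beurlingReal_sub_sinc_sq_le (x := δ * (n + 1)) (by positivity)
    have h2 : Real.sinc (π * (δ * (n + 1))) ^ 2 ≤ 1 := by
      rw [sq_le_one_iff_abs_le_one]; exact Real.abs_sinc_le_one _
    simp only [hw]; linarith
  have hw_diff : ∀ (n : ℕ) {δ : ℝ}, 0 < δ → |w (n + 1) δ - w n δ| ≤ C / (2 * ((n:ℝ) + 1)) := by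
    intro n δ hδ
    have h1 := abs_vaalerH_sub_le (a := δ * (n + 1)) (b := δ * (n + 1 + 1)) (by positivity)
      (by nlinarith)
    have h2 : 10 * Real.exp (2 * π) / (1 + (δ * (n + 1)) ^ 2) * (δ * (n + 1 + 1) - δ * (n + 1))
        ≤ C / (2 * ((n:ℝ) + 1)) := by
      rw [show δ * ((n:ℝ) + 1 + 1) - δ * (n + 1) = δ by ring, ← hC, div_mul_eq_mul_div,
        div_le_div_iff₀ (by positivity) (by positivity)]
      have hC0 : 0 ≤ C := by positivity
      nlinarith [mul_nonneg hC0 (sq_nonneg (δ * (n + 1) - 1))]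
    have h3 : w (n + 1) δ - w n δ = -((beurlingReal (δ * (n + 1 + 1)) -
        Real.sinc (π * (δ * (n + 1 + 1))) ^ 2) - (beurlingReal (δ * (n + 1)) -
        Real.sinc (π * (δ * (n + 1))) ^ 2)) := by
      simp only [hw]; push_cast; ring
    rw [h3, abs_neg]
    exact h1.trans h2
  -- the dominating sequence
  have hq0 : (0:ℝ) ≤ q := Nat.cast_nonneg q
  set bound : ℕ → ℝ := fun n => q * C / ((n:ℝ) + 1) ^ 2 with hbound
  have hbound_sum : Summable bound := by
    have := ((summable_nat_add_iff 1).2 (Real.summable_one_div_nat_pow.2 one_lt_two)).mul_left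
      (q * C)
    refine this.congr fun n => ?_
    push_cast; ring
  have hD_le : ∀ (n : ℕ) {δ : ℝ}, 0 < δ → ‖Rt (n + 1) * ((w (n + 1) δ : ℂ) - w n δ)‖ ≤ bound n := by
    intro n δ hδ
    rw [norm_mul, ← Complex.ofReal_sub, Complex.norm_real, Real.norm_eq_abs]
    have h1 := hRt_le (n + 1)
    have h2 := hw_diff n hδ
    push_cast at h1
    have hC0 : 0 ≤ C := by positivity
    calc ‖Rt (n + 1)‖ * |w (n + 1) δ - w n δ|
        ≤ (2 * q / ((n:ℝ) + 1 + 1)) * (C / (2 * ((n:ℝ) + 1))) :=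
          mul_le_mul h1 h2 (abs_nonneg _) (by positivity)
      _ ≤ bound n := by
          simp only [hbound]
          rw [div_mul_div_comm, div_le_div_iff₀ (by positivity) (by positivity)]
          nlinarith [mul_nonneg (mul_nonneg hq0 hC0) (by positivity : (0:ℝ) ≤ ((n:ℝ) + 1) ^ 2)]
  have hD_summable : ∀ {δ : ℝ}, 0 < δ →
      Summable fun n => Rt (n + 1) * ((w (n + 1) δ : ℂ) - w n δ) :=
    fun hδ => Summable.of_norm_bounded (g := bound) hbound_sum fun n => hD_le n hδ
  -- the identity `A(δ) = L·w₀(δ) + Σ R_{n+1}(w_{n+1} − w_n)` for `0 < δ ≤ 1`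
  have hA_eq : ∀ {δ : ℝ}, 0 < δ → δ ≤ 1 →
      ∑' n : ℕ, χ ((n + 1 : ℕ) : ZMod q) *
        (((1 - (beurlingReal (δ * (n + 1)) - Real.sinc (π * (δ * (n + 1))) ^ 2)) / (n + 1) : ℝ) : ℂ)
        = L * (w 0 δ : ℂ) + ∑' n, Rt (n + 1) * ((w (n + 1) δ : ℂ) - w n δ) := by
    intro δ hδ hδ1
    have hs := summable_smoothedLSeries χ hδ hδ1
    have h1 : Tendsto (fun N => ∑ n ∈ Finset.range N, a n * (w n δ : ℂ)) atTop
        (𝓝 (∑' n : ℕ, χ ((n + 1 : ℕ) : ZMod q) *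
          (((1 - (beurlingReal (δ * (n + 1)) - Real.sinc (π * (δ * (n + 1))) ^ 2)) / (n + 1) : ℝ) : ℂ))) := by
      refine hs.hasSum.tendsto_sum_nat.congr fun N => Finset.sum_congr rfl fun n _ => hterm n δ
    have hRN : Tendsto (fun N => Rt N * (w N δ : ℂ)) atTop (𝓝 0) := by
      refine squeeze_zero_norm (a := fun N : ℕ => 2 * q / ((N : ℝ) + 1)) (fun N => ?_) ?_
      · rw [norm_mul, Complex.norm_real, Real.norm_eq_abs, abs_of_nonneg (hw_nonneg N hδ)]
        exact (mul_le_of_le_one_right (norm_nonneg _) (hw_le_one N hδ)).trans (hRt_le N)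
      · have := (tendsto_const_div_atTop_nhds_zero_nat (2 * (q:ℝ))).comp (tendsto_add_atTop_nat 1)
        refine this.congr fun N => ?_
        simp [Function.comp]
    have h2 : Tendsto (fun N => Rt 0 * (w 0 δ : ℂ) - Rt N * (w N δ : ℂ)
        + ∑ n ∈ Finset.range N, Rt (n + 1) * ((w (n + 1) δ : ℂ) - w n δ)) atTop
        (𝓝 (Rt 0 * (w 0 δ : ℂ) - 0 + ∑' n, Rt (n + 1) * ((w (n + 1) δ : ℂ) - w n δ))) :=
      (tendsto_const_nhds.sub hRN).add (hD_summable hδ).hasSum.tendsto_sum_nat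
    have h3 := tendsto_nhds_unique h1 (h2.congr fun N => (habel δ N).symm)
    rw [h3, hRt0, sub_zero]
  -- continuity of the weights at `δ = 0`
  have hw_tendsto : ∀ n, Tendsto (fun δ => (w n δ : ℂ)) (𝓝[>] 0) (𝓝 1) := by
    intro n
    have hc : Continuous fun δ : ℝ => (w n δ : ℂ) := by
      simp only [hw]
      exact Complex.continuous_ofReal.comp (continuous_const.sub
        (continuous_vaalerH.comp (continuous_id.mul continuous_const)))
    have := hc.tendsto 0
    have h0 : (w n 0 : ℂ) = 1 := by
      simp only [hw, zero_mul, mul_zero]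
      rw [show beurlingReal 0 - Real.sinc 0 ^ 2 = 0 by simpa using vaalerH_zero]
      simp
    rw [h0] at this
    exact this.mono_left nhdsWithin_le_nhds
  have hmem : ∀ᶠ δ in 𝓝[>] (0:ℝ), 0 < δ ∧ δ ≤ 1 := by
    filter_upwards [Ioc_mem_nhdsGT zero_lt_one] with δ hδ using hδ
  have hD_tendsto : Tendsto (fun δ => ∑' n, Rt (n + 1) * ((w (n + 1) δ : ℂ) - w n δ))
      (𝓝[>] 0) (𝓝 0) := by
    have h := tendsto_tsum_of_dominated_convergence (𝓕 := 𝓝[>] (0:ℝ))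
      (f := fun δ n => Rt (n + 1) * ((w (n + 1) δ : ℂ) - w n δ)) (g := fun _ => (0:ℂ))
      (bound := bound) hbound_sum ?_ ?_
    · simpa using h
    · intro n
      have : Tendsto (fun δ => Rt (n + 1) * ((w (n + 1) δ : ℂ) - w n δ)) (𝓝[>] 0)
          (𝓝 (Rt (n + 1) * (1 - 1))) :=
        tendsto_const_nhds.mul ((hw_tendsto (n + 1)).sub (hw_tendsto n))
      simpa using this
    · filter_upwards [hmem] with δ hδ n using hD_le n hδ.1
  have hmain : Tendsto (fun δ => L * (w 0 δ : ℂ) + ∑' n, Rt (n + 1) * ((w (n + 1) δ : ℂ) - w n δ))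
      (𝓝[>] 0) (𝓝 (L * 1 + 0)) :=
    (tendsto_const_nhds.mul (hw_tendsto 0)).add hD_tendsto
  rw [mul_one, add_zero] at hmain
  refine hmain.congr' ?_
  filter_upwards [hmem] with δ hδ
  exact (hA_eq hδ.1 hδ.2).symm

variable {W : ℝ → ℝ}

omit [NeZero q] in
/-- **`A'(δ) = −Σ χ(n) W(δn)`** for `0 < δ ≤ 1` (term-wise differentiation, locally uniformly
dominated by `10e^{2π}/(1 + δ²n²/4)`). [cite: Ramare2001LOneApproximateFormulae, §IV p. 256 (proof of Thm. 1)] -/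
theorem hasDerivAt_smoothedLSeries
    (hW : W = fun x => 4 * ∫ t in (0:ℝ)..1,
      (t + π * t * (1 - t) * (Real.cos (π * t) / Real.sin (π * t))) * Real.cos (2 * π * x * t))
    {δ : ℝ} (hδ : 0 < δ) (hδ1 : δ ≤ 1) :
    HasDerivAt (fun y : ℝ => ∑' n : ℕ, χ ((n + 1 : ℕ) : ZMod q) *
        (((1 - (beurlingReal (y * (n + 1)) - Real.sinc (π * (y * (n + 1))) ^ 2)) / (n + 1) : ℝ) : ℂ))
      (-∑' n : ℕ, χ ((n + 1 : ℕ) : ZMod q) * (W (δ * (n + 1)) : ℂ)) δ := by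
  set term : ℕ → ℝ → ℂ := fun n y => χ ((n + 1 : ℕ) : ZMod q) *
    (((1 - (beurlingReal (y * (n + 1)) - Real.sinc (π * (y * (n + 1))) ^ 2)) / (n + 1) : ℝ) : ℂ)
    with hterm
  have hderiv : ∀ (n : ℕ) (y : ℝ),
      HasDerivAt (term n) (χ ((n + 1 : ℕ) : ZMod q) * ((-W (y * (n + 1)) : ℝ) : ℂ)) y := by
    intro n y
    have hn : (0 : ℝ) < n + 1 := by positivity
    have h1 := hasDerivAt_beurlingReal_sub_sinc_sq (y * (n + 1))
    have h2 : HasDerivAt (fun y : ℝ => y * (n + 1)) ((n : ℝ) + 1) y := by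
      simpa using (hasDerivAt_id y).mul_const ((n : ℝ) + 1)
    have h3 := h1.comp y h2
    have h4 := (((h3.const_sub 1).div_const ((n : ℝ) + 1)).ofReal_comp).const_mul
      (χ ((n + 1 : ℕ) : ZMod q))
    refine (h4.congr_of_eventuallyEq (Eventually.of_forall fun z => by
      simp [hterm, Function.comp])).congr_deriv ?_
    rw [neg_div, mul_div_cancel_right₀ _ hn.ne', hW]
  have hsumm := summable_smoothedLSeries χ hδ hδ1
  have hyI : δ ∈ Set.Ioi (δ / 2) := by simp only [Set.mem_Ioi]; linarith
  have hF := hasDerivAt_tsum_of_isPreconnected (t := Ioi (δ / 2)) (y₀ := δ) (y := δ)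
    (u := fun n : ℕ => 10 * Real.exp (2 * π) / (1 + (δ / 2) ^ 2 * ((n : ℝ) + 1) ^ 2)) ?_
    isOpen_Ioi isPreconnected_Ioi (fun n z _ => hderiv n z) ?_ hyI hsumm hyI
  · refine (hF.congr_of_eventuallyEq (Eventually.of_forall fun z => by simp [hterm])).congr_deriv ?_
    rw [← tsum_neg]
    refine tsum_congr fun n => ?_
    push_cast; ring
  · have : Summable fun n : ℕ => 10 * Real.exp (2 * π) / (δ / 2) ^ 2 * (1 / ((n : ℝ) + 1) ^ 2) := by
      have := (summable_nat_add_iff 1 |>.2 (Real.summable_one_div_nat_pow.2 one_lt_two)).mul_left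
        (10 * Real.exp (2 * π) / (δ / 2) ^ 2)
      refine this.congr fun n => ?_
      push_cast; ring_nf
    refine Summable.of_nonneg_of_le (fun n => by positivity) (fun n => ?_) this
    have hpos : 0 < (δ / 2) ^ 2 * ((n : ℝ) + 1) ^ 2 := by positivity
    have heq : 10 * Real.exp (2 * π) / (δ / 2) ^ 2 * (1 / ((n : ℝ) + 1) ^ 2)
        = 10 * Real.exp (2 * π) / ((δ / 2) ^ 2 * ((n : ℝ) + 1) ^ 2) := by
      rw [mul_one_div, div_div]
    rw [heq]
    exact div_le_div_of_nonneg_left (by positivity) hpos (by linarith)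
  · intro n z hz
    rw [norm_mul, Complex.norm_real, norm_neg, Real.norm_eq_abs, hW]
    refine (mul_le_of_le_one_left (abs_nonneg _) (χ.norm_le_one _)).trans ?_
    refine (abs_vaalerW_le_div_one_add_sq _).trans ?_
    apply div_le_div_of_nonneg_left (by positivity) (by positivity)
    have hz' : δ / 2 < z := hz
    have : (δ / 2) ^ 2 * ((n : ℝ) + 1) ^ 2 ≤ (z * (n + 1)) ^ 2 := by
      rw [mul_pow]; gcongr
    linarith

end Smoothed

/-! ## Poisson summation for the derivative and the dual term -/

section Dual

variable {Φ G W J : ℝ → ℝ}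

/-- **Twisted Poisson summation for `Σ χ(n)W(δn)`** (even primitive `χ`, `0 < δ < 1`):
`Σ_{n≥1} χ(n) W(δn) = (δq)⁻¹ τ(χ) Σ_{1 ≤ m ≤ q} χ̄(m) G(m/(δq))`.
[cite: Ramare2001LOneApproximateFormulae, Lemma 11 p. 256] -/
theorem tsum_char_mul_vaalerW_eq (hχ : χ.IsPrimitive) (hχ1 : χ ≠ 1) (heven : χ.Even)
    (hΦ : Φ = fun u => Real.cos (π * u) / (Real.sinc (π * u) + Real.sinc (π * (1 - u))) + u)
    (hG : G = fun y => if |y| ≤ 1 then 2 * Φ |y| else 0)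
    (hW : W = fun x => 4 * ∫ t in (0:ℝ)..1,
      (t + π * t * (1 - t) * (Real.cos (π * t) / Real.sin (π * t))) * Real.cos (2 * π * x * t))
    {δ : ℝ} (hδ : 0 < δ) (hδ1 : δ < 1) :
    ∑' n : ℕ, χ ((n + 1 : ℕ) : ZMod q) * (W (δ * (n + 1)) : ℂ)
      = (((δ * q)⁻¹ : ℝ) : ℂ) * gaussSum χ (ZMod.stdAddChar (N := q)) *
        ∑ m ∈ Finset.range q, χ⁻¹ ((m + 1 : ℕ) : ZMod q) * (G ((m + 1) / (δ * q)) : ℂ) := by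
  have hq1 : q ≠ 1 := by rintro rfl; exact hχ1 χ.level_one
  have hqne : q ≠ 0 := NeZero.ne q
  haveI : Fact (1 < q) := ⟨by omega⟩
  have hq0 : (0:ℝ) < q := by positivity
  have hneg : ∀ x : ZMod q, χ (-x) = χ x := fun x => by
    rw [neg_eq_neg_one_mul, map_mul, show χ (-1) = 1 from heven, one_mul]
  have hneg' : ∀ x : ZMod q, χ⁻¹ (-x) = χ⁻¹ x := fun x => by
    rw [MulChar.inv_apply_eq_inv', MulChar.inv_apply_eq_inv', hneg]
  have hGc : Continuous fun u => (G u : ℂ) :=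
    Complex.continuous_ofReal.comp (continuous_vaalerG hΦ hG)
  have hG0 : ∀ u : ℝ, 1 ≤ |u| → (G u : ℂ) = 0 := fun u hu => by
    rw [vaalerG_eq_zero hΦ hG hu, Complex.ofReal_zero]
  have hV : ∀ y : ℝ, (W y : ℂ) = ∫ u : ℝ, (G u : ℂ) * Complex.exp (2 * π * Complex.I * u * y) :=
    fun y => by rw [integral_vaalerG_mul_cexp hΦ hG y]; simp only [hW]
  have hdec : ∀ y : ℝ, ‖(W y : ℂ)‖ ≤ 10 * Real.exp (2 * π) / (1 + y ^ 2) := fun y => by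
    rw [Complex.norm_real, Real.norm_eq_abs]; simp only [hW]; exact abs_vaalerW_le_div_one_add_sq y
  have hP := tsum_char_mul_eq_of_bandlimited hχ hGc hG0 hV hdec hδ
  have hWneg : ∀ x, W (-x) = W x := fun x => by simp only [hW]; exact vaalerW_neg x
  have hL : ∑' n : ℤ, χ (n : ZMod q) * (W (δ * n) : ℂ)
      = 2 * ∑' n : ℕ, χ ((n + 1 : ℕ) : ZMod q) * (W (δ * (n + 1)) : ℂ) := by
    rw [tsum_int_eq_two_mul_tsum_nat (f := fun n : ℤ => χ (n : ZMod q) * (W (δ * n) : ℂ)) ?_ ?_ ?_]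
    · congr 1
      refine tsum_congr fun n => ?_
      push_cast; ring_nf
    · exact summable_int_of_norm_le_div hδ fun n => by
        rw [norm_mul]
        exact (mul_le_of_le_one_left (norm_nonneg _) (χ.norm_le_one _)).trans (hdec _)
    · intro n; simp only [Int.cast_neg, hneg, mul_neg, hWneg]
    · simp [MulChar.map_zero]
  have hR : ∑' m : ℤ, χ⁻¹ (m : ZMod q) * (G (m / (δ * q)) : ℂ)
      = 2 * ∑ m ∈ Finset.range q, χ⁻¹ ((m + 1 : ℕ) : ZMod q) * (G ((m + 1) / (δ * q)) : ℂ) := by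
    rw [tsum_int_eq_two_mul_tsum_nat (f := fun m : ℤ => χ⁻¹ (m : ZMod q) * (G (m / (δ * q)) : ℂ))
      ?_ ?_ ?_]
    · congr 1
      rw [tsum_eq_sum (s := Finset.range q) ?_]
      · refine Finset.sum_congr rfl fun m _ => ?_
        push_cast; ring_nf
      · intro m hm
        simp only [Finset.mem_range, not_lt] at hm
        have hm' : (q:ℝ) ≤ m := by exact_mod_cast hm
        rw [hG0 _ ?_, mul_zero]
        push_cast
        rw [abs_of_nonneg (by positivity), le_div_iff₀ (by positivity), one_mul]
        nlinarith
    · exact summable_samples_of_bandlimited hG0 (fun m => χ⁻¹ (m : ZMod q)) (by positivity)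
    · intro m; simp only [Int.cast_neg, hneg', neg_div, vaalerG_neg hG]
    · simp [MulChar.map_zero]
  rw [hL, hR] at hP
  calc ∑' n : ℕ, χ ((n + 1 : ℕ) : ZMod q) * (W (δ * (n + 1)) : ℂ)
      = (1 / 2 : ℂ) * (2 * ∑' n : ℕ, χ ((n + 1 : ℕ) : ZMod q) * (W (δ * (n + 1)) : ℂ)) := by ring
    _ = _ := by rw [hP]; ring

/-- **Derivative of the dual sum**: `d/dδ Σ_m c_m J((m+1)/(δκ)) = Σ_m c_m · 2Φ(min((m+1)/(δκ),1))/δ`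
(`J'(y) = −2Φ(min(y,1))/y`). [cite: Ramare2001LOneApproximateFormulae, Lemma 15 p. 259] -/
theorem hasDerivAt_dualSum
    (hΦ : Φ = fun u => Real.cos (π * u) / (Real.sinc (π * u) + Real.sinc (π * (1 - u))) + u)
    (hJ : J = fun y => 2 * ∫ u in y..1, Φ (min u 1) / u) (c : ℕ → ℂ) (M : ℕ) {κ : ℝ} (hκ : 0 < κ)
    {δ : ℝ} (hδ : 0 < δ) :
    HasDerivAt (fun y : ℝ => ∑ m ∈ Finset.range M, c m * (J ((m + 1) / (y * κ)) : ℂ))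
      (∑ m ∈ Finset.range M, c m * ((2 * Φ (min ((m + 1) / (δ * κ)) 1) / δ : ℝ) : ℂ)) δ := by
  refine HasDerivAt.fun_sum fun m _ => ?_
  have hm : (0:ℝ) < (m:ℝ) + 1 := by positivity
  have hy : 0 < ((m:ℝ) + 1) / κ * δ⁻¹ := by positivity
  have hJ' := hasDerivAt_vaalerJ hΦ hJ hy
  have hinner : HasDerivAt (fun y : ℝ => ((m:ℝ) + 1) / κ * y⁻¹) (((m:ℝ) + 1) / κ * (-(δ ^ 2)⁻¹)) δ :=
    (hasDerivAt_inv hδ.ne').const_mul _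
  have hcomp := ((hJ'.comp δ hinner).ofReal_comp).const_mul (c m)
  have hfun : (fun y : ℝ => c m * (J ((m + 1) / (y * κ)) : ℂ))
      = fun y => c m * ((J ∘ fun y : ℝ => ((m:ℝ) + 1) / κ * y⁻¹) y : ℂ) := by
    funext y
    simp only [Function.comp]
    rw [show ((m:ℝ) + 1) / (y * κ) = ((m:ℝ) + 1) / κ * y⁻¹ by ring]
  rw [hfun]
  refine hcomp.congr_deriv ?_
  have harg : ((m:ℝ) + 1) / κ * δ⁻¹ = ((m:ℝ) + 1) / (δ * κ) := by field_simp
  rw [harg]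
  congr 1
  rw [Complex.ofReal_inj]
  have hδ0 : δ ≠ 0 := hδ.ne'
  have hκ0 : κ ≠ 0 := hκ.ne'
  have hm0 : (m:ℝ) + 1 ≠ 0 := hm.ne'
  field_simp

end Dual

/-! ## Proposition 2 (even characters, with `F₃ = H`) -/

section Formula

variable {Φ J : ℝ → ℝ}

/-- **Ramaré's Proposition 2 for even characters** (with Vaaler's `F₃ = H = B − K` and honest sign):
for `χ` even primitive mod `q`, `χ ≠ 1`, and `0 < δ < 1`,
`L(1,χ) = Σ_{n≥1} χ(n)(1 − H(δn))/n + (τ(χ)/q) Σ_{1 ≤ m ≤ q} χ̄(m) J(m/(δq))`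
(`J = j` of (1.9); the terms with `m > δq` vanish).  Proof: both sides are differentiable in `δ`
with equal derivatives (term-wise differentiation + twisted Poisson summation), the dual sum vanishes
for `δ < 1/q`, and the smoothed sum tends to `L(1,χ)` as `δ → 0⁺`.
[cite: Ramare2001LOneApproximateFormulae, Prop. 2 p. 247] -/
theorem LFunction_one_eq_smoothed_add_dual (hχ : χ.IsPrimitive) (hχ1 : χ ≠ 1) (heven : χ.Even)
    (hΦ : Φ = fun u => Real.cos (π * u) / (Real.sinc (π * u) + Real.sinc (π * (1 - u))) + u)
    (hJ : J = fun y => 2 * ∫ u in y..1, Φ (min u 1) / u) {δ : ℝ} (hδ : 0 < δ) (hδ1 : δ < 1) :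
    χ.LFunction 1 = (∑' n : ℕ, χ ((n + 1 : ℕ) : ZMod q) *
        (((1 - (beurlingReal (δ * (n + 1)) - Real.sinc (π * (δ * (n + 1))) ^ 2)) / (n + 1) : ℝ) : ℂ))
      + gaussSum χ (ZMod.stdAddChar (N := q)) / q *
        ∑ m ∈ Finset.range q, χ⁻¹ ((m + 1 : ℕ) : ZMod q) * (J ((m + 1) / (δ * q)) : ℂ) := by
  have hq1 : q ≠ 1 := by rintro rfl; exact hχ1 χ.level_one
  have hqne : q ≠ 0 := NeZero.ne q
  have hq0 : (0:ℝ) < q := by positivity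
  set G : ℝ → ℝ := fun y => if |y| ≤ 1 then 2 * Φ |y| else 0 with hG
  set W : ℝ → ℝ := fun x => 4 * ∫ t in (0:ℝ)..1,
      (t + π * t * (1 - t) * (Real.cos (π * t) / Real.sin (π * t))) * Real.cos (2 * π * x * t) with hW
  set A : ℝ → ℂ := fun y => ∑' n : ℕ, χ ((n + 1 : ℕ) : ZMod q) *
    (((1 - (beurlingReal (y * (n + 1)) - Real.sinc (π * (y * (n + 1))) ^ 2)) / (n + 1) : ℝ) : ℂ)
    with hA
  set T : ℝ → ℂ := fun y => gaussSum χ (ZMod.stdAddChar (N := q)) / q *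
    ∑ m ∈ Finset.range q, χ⁻¹ ((m + 1 : ℕ) : ZMod q) * (J ((m + 1) / (y * q)) : ℂ) with hT
  set S : ℝ → ℂ := fun y => ∑' n : ℕ, χ ((n + 1 : ℕ) : ZMod q) * (W (y * (n + 1)) : ℂ) with hS
  -- derivatives
  have hAd : ∀ y : ℝ, 0 < y → y ≤ 1 → HasDerivAt A (-S y) y := fun y hy hy1 =>
    hasDerivAt_smoothedLSeries χ hW hy hy1
  have hTd : ∀ y : ℝ, 0 < y → y < 1 → HasDerivAt T (S y) y := by
    intro y hy hy1
    have h1 := (hasDerivAt_dualSum hΦ hJ (fun m => χ⁻¹ ((m + 1 : ℕ) : ZMod q)) q hq0 hy).const_mul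
      (gaussSum χ (ZMod.stdAddChar (N := q)) / q)
    refine h1.congr_deriv ?_
    simp only [hS]
    rw [tsum_char_mul_vaalerW_eq χ hχ hχ1 heven hΦ hG hW hy hy1, Finset.mul_sum, Finset.mul_sum]
    refine Finset.sum_congr rfl fun m _ => ?_
    rw [vaalerG_eq_two_mul_min hΦ hG (by positivity : (0:ℝ) ≤ ((m:ℝ) + 1) / (y * q))]
    have hy0 : (y : ℂ) ≠ 0 := Complex.ofReal_ne_zero.2 hy.ne'
    have hq0' : (q : ℂ) ≠ 0 := Nat.cast_ne_zero.2 hqne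
    push_cast
    field_simp
  have hE : ∀ y : ℝ, 0 < y → y < 1 → HasDerivAt (fun z => A z + T z) 0 y := fun y hy hy1 => by
    have := (hAd y hy hy1.le).add (hTd y hy hy1)
    rw [neg_add_cancel] at this
    exact this
  have hconst : ∀ y y' : ℝ, 0 < y → y < 1 → 0 < y' → y' ≤ y → A y' + T y' = A y + T y := by
    intro y y' hy hy1 hy' hyy'
    have h := constant_of_has_deriv_right_zero (f := fun z => A z + T z) (a := y') (b := y)
      (fun z hz => (hE z (by linarith [hz.1]) (by linarith [hz.2])).continuousAt.continuousWithinAt)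
      (fun z hz => (hE z (by linarith [hz.1]) (by linarith [hz.2])).hasDerivWithinAt) y
      ⟨hyy', le_rfl⟩
    exact h.symm
  -- `T(y') = 0` for `y' < 1/q`
  have hT0 : ∀ y' : ℝ, 0 < y' → y' < 1 / q → T y' = 0 := by
    intro y' hy' hyq
    have hyq' : y' * q < 1 := by rwa [lt_div_iff₀ hq0] at hyq
    simp only [hT]
    rw [Finset.sum_eq_zero fun m _ => ?_, mul_zero]
    rw [vaalerJ_eq_zero hΦ hJ ?_, Complex.ofReal_zero, mul_zero]
    rw [le_div_iff₀ (by positivity), one_mul]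
    have : (0:ℝ) ≤ m := Nat.cast_nonneg m
    linarith
  -- the limit `δ → 0⁺`
  have hlim : Tendsto A (𝓝[>] 0) (𝓝 (χ.LFunction 1)) := tendsto_smoothedLSeries χ hχ1
  have hAconst : ∀ᶠ y' in 𝓝[>] (0:ℝ), A y' = A δ + T δ := by
    have hm : Ioo (0:ℝ) (min δ (1 / q)) ∈ 𝓝[>] (0:ℝ) := Ioo_mem_nhdsGT (lt_min hδ (by positivity))
    filter_upwards [hm] with y' hy'
    have h1 := hconst δ y' hδ hδ1 hy'.1 (le_trans hy'.2.le (min_le_left _ _))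
    rw [hT0 y' hy'.1 (lt_of_lt_of_le hy'.2 (min_le_right _ _)), add_zero] at h1
    exact h1
  have h2 : Tendsto A (𝓝[>] 0) (𝓝 (A δ + T δ)) :=
    tendsto_const_nhds.congr' (hAconst.mono fun y h => h.symm)
  have h3 := tendsto_nhds_unique hlim h2
  rw [h3]

end Formula

/-! ## Corollary 1 (even characters) -/

section Corollary

/-- `exp n ≤ c` from a decimal bound `2.7182818286ⁿ ≤ c`. [folklore] -/
private theorem exp_nat_le {n : ℕ} {c : ℝ} (h : (2.7182818286 : ℝ) ^ n ≤ c) : Real.exp n ≤ c := by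
  calc Real.exp n = Real.exp 1 ^ n := by rw [← Real.exp_nat_mul, mul_one]
    _ ≤ (2.7182818286 : ℝ) ^ n :=
        pow_le_pow_left₀ (Real.exp_pos _).le Real.exp_one_lt_d9.le n
    _ ≤ c := h

/-- **Large conductors** (`log q ≥ 10`): `|L(1,χ)| ≤ ½ log q` for even primitive `χ ≠ 1`, by
Proposition 2 at `δ = q^{-1/2}`, Lemma 16 (`Σ(1 − H(δn))/n = −log δ − 1 + δ`), `|τ(χ)| = √q`, and the
dual-sum bound `Σ J(m/√q) ≤ √q − log √q + (5 − log π)`: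
`|L(1,χ)| ≤ ½ log q − (½ log q − 6 + log π)/√q`.
[cite: Ramare2001LOneApproximateFormulae, Cor. 1 p. 247 / §VI p. 262] -/
theorem norm_LFunction_one_le_half_log_of_log_ge (hχ : χ.IsPrimitive) (hχ1 : χ ≠ 1)
    (heven : χ.Even) (hq : 10 ≤ Real.log q) : ‖χ.LFunction 1‖ ≤ Real.log q / 2 := by
  have hqne : q ≠ 0 := NeZero.ne q
  have hq0 : (0:ℝ) < q := by positivity
  have hq1 : (1:ℝ) < q := lt_of_not_ge fun h => by
    have := Real.log_nonpos hq0.le h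
    linarith
  set Φ : ℝ → ℝ := fun u => Real.cos (π * u) / (Real.sinc (π * u) + Real.sinc (π * (1 - u))) + u
    with hΦ
  set J : ℝ → ℝ := fun y => 2 * ∫ u in y..1, Φ (min u 1) / u with hJ
  set s : ℝ := Real.sqrt q with hs
  have hs0 : 0 < s := Real.sqrt_pos.2 hq0
  have hsq : s ^ 2 = q := Real.sq_sqrt hq0.le
  have hs1 : 1 < s := by rw [hs, show (1:ℝ) = Real.sqrt 1 from Real.sqrt_one.symm]; exact Real.sqrt_lt_sqrt zero_le_one hq1
  set δ : ℝ := 1 / s with hδ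
  have hδ0 : 0 < δ := by positivity
  have hδ1 : δ < 1 := by rw [hδ, div_lt_one hs0]; exact hs1
  have hδq : δ * q = s := by rw [hδ, ← hsq]; field_simp
  have hformula := LFunction_one_eq_smoothed_add_dual χ hχ hχ1 heven hΦ hJ hδ0 hδ1
  -- the smoothed sum
  have hA : ‖∑' n : ℕ, χ ((n + 1 : ℕ) : ZMod q) *
      (((1 - (beurlingReal (δ * (n + 1)) - Real.sinc (π * (δ * (n + 1))) ^ 2)) / (n + 1) : ℝ) : ℂ)‖
        ≤ -Real.log δ - 1 + δ := by
    refine tsum_of_norm_bounded (hasSum_one_sub_vaalerH_div hδ0 hδ1.le) fun n => ?_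
    rw [norm_mul, Complex.norm_real, Real.norm_eq_abs,
      abs_of_nonneg (div_nonneg (one_sub_beurlingReal_sub_sinc_sq_nonneg (by positivity)) (by positivity))]
    exact mul_le_of_le_one_left (div_nonneg (one_sub_beurlingReal_sub_sinc_sq_nonneg (by positivity))
      (by positivity)) (χ.norm_le_one _)
  -- the dual sum
  have hτ : ‖gaussSum χ (ZMod.stdAddChar (N := q))‖ = s := by
    rw [← Real.sqrt_sq (norm_nonneg _), Literature.NumberTheory.Sieve.LargeSieve.norm_gaussSum_sq hχ]
  have hJsum := sum_vaalerJ_le hΦ hJ hs1.le q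
  have hJnn : ∀ m : ℕ, 0 ≤ J (((m:ℝ) + 1) / s) := fun m => vaalerJ_nonneg hΦ hJ (by positivity)
  have hT : ‖gaussSum χ (ZMod.stdAddChar (N := q)) / q *
      ∑ m ∈ Finset.range q, χ⁻¹ ((m + 1 : ℕ) : ZMod q) * (J ((m + 1) / (δ * q)) : ℂ)‖
        ≤ 1 / s * (s - Real.log s + (5 - Real.log π)) := by
    rw [norm_mul, norm_div, hτ, Complex.norm_natCast, hδq]
    have h1 : ‖∑ m ∈ Finset.range q, χ⁻¹ ((m + 1 : ℕ) : ZMod q) * (J ((m + 1) / s) : ℂ)‖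
        ≤ ∑ m ∈ Finset.range q, J ((m + 1) / s) := by
      refine (norm_sum_le _ _).trans (Finset.sum_le_sum fun m _ => ?_)
      rw [norm_mul, Complex.norm_real, Real.norm_eq_abs, abs_of_nonneg (hJnn m)]
      exact mul_le_of_le_one_left (hJnn m) (DirichletCharacter.norm_le_one _ _)
    have h2 : s / q = 1 / s := by rw [← hsq]; field_simp
    rw [h2]
    exact mul_le_mul_of_nonneg_left (h1.trans hJsum) (by positivity)
  have hlogδ : Real.log δ = -Real.log s := by rw [hδ, one_div, Real.log_inv]
  have hlogq : Real.log q = 2 * Real.log s := by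
    rw [← hsq, Real.log_pow]; norm_num
  have hlogs : 5 ≤ Real.log s := by linarith
  have hπ : 1 ≤ Real.log π := by
    have := Literature.Analysis.SpecialFunctions.Real.log_pi_gt_d20
    linarith
  calc ‖χ.LFunction 1‖
      ≤ (-Real.log δ - 1 + δ) + 1 / s * (s - Real.log s + (5 - Real.log π)) := by
        rw [hformula]; exact (norm_add_le _ _).trans (add_le_add hA hT)
    _ = Real.log s - (Real.log s - (5 - Real.log π) - 1) / s := by
        rw [hlogδ, hδ]; field_simp; ring
    _ ≤ Real.log s := by
        have : 0 ≤ (Real.log s - (5 - Real.log π) - 1) / s := div_nonneg (by linarith) hs0.le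
        linarith
    _ = Real.log q / 2 := by rw [hlogq]; ring

/-- **Small conductors** (`q ≤ 25000`): `|L(1,χ)| ≤ ½ log q` for even primitive `χ ≠ 1`, from
Louboutin's `|L(1,χ)| ≤ ½ log q + µ − (½ log q − µ)/√q` (`µ < 0.0231`, tree
`Louboutin2001.norm_LFunction_one_le_sub`), since `(√q + 1)µ ≤ ½ log q` for `2 ≤ q ≤ 25000`.
[cite: Louboutin2001CJM, Thm 7 (15) p. 1197] -/
theorem norm_LFunction_one_le_half_log_of_le (hχ : χ.IsPrimitive) (hχ1 : χ ≠ 1) (heven : χ.Even)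
    (hq : (q:ℝ) ≤ 25000) : ‖χ.LFunction 1‖ ≤ Real.log q / 2 := by
  have hq1 : q ≠ 1 := by rintro rfl; exact hχ1 χ.level_one
  have hqne : q ≠ 0 := NeZero.ne q
  have hq2 : (2:ℝ) ≤ q := by exact_mod_cast (show 2 ≤ q by omega)
  have hq0 : (0:ℝ) < q := by positivity
  have h := Louboutin2001.norm_LFunction_one_le_sub χ hχ hχ1 heven
  have hmu := Louboutin2001.mu_lt
  have hmu0 : 0 < Louboutin2001.mu := lt_trans (by norm_num) Louboutin2001.lt_mu
  have hr : (q:ℝ) ^ (1 / 2 : ℝ) = Real.sqrt q := (Real.sqrt_eq_rpow _).symm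
  rw [hr] at h
  set r := Real.sqrt q with hrdef
  have hr0 : 0 < r := Real.sqrt_pos.2 hq0
  have hrle : ∀ {c : ℝ}, 0 ≤ c → (q:ℝ) ≤ c ^ 2 → r ≤ c := fun {c} hc hqc => by
    rw [hrdef, ← Real.sqrt_sq hc]; exact Real.sqrt_le_sqrt hqc
  suffices hkey : (r + 1) * Louboutin2001.mu ≤ Real.log q / 2 by
    have : Louboutin2001.mu - (Real.log q / 2 - Louboutin2001.mu) / r ≤ 0 := by
      rw [sub_nonpos, le_div_iff₀ hr0]; nlinarith
    linarith
  have hlog2 : Real.log 2 ≤ Real.log q := Real.log_le_log two_pos hq2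
  have hl2 := Real.log_two_gt_d9
  by_cases h100 : (q:ℝ) ≤ 100
  · have hr10 : r ≤ 10 := hrle (by norm_num) (h100.trans (by norm_num))
    nlinarith
  by_cases h7000 : (q:ℝ) ≤ 7000
  · have hr84 : r ≤ 84 := hrle (by norm_num) (h7000.trans (by norm_num))
    have hlog : (4:ℝ) ≤ Real.log q := by
      rw [Real.le_log_iff_exp_le hq0]
      have := exp_nat_le (n := 4) (c := 100) (by norm_num)
      push_cast at this
      linarith
    nlinarith
  · have hr159 : r ≤ 159 := hrle (by norm_num) (hq.trans (by norm_num))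
    have hlog : (8:ℝ) ≤ Real.log q := by
      rw [Real.le_log_iff_exp_le hq0]
      have := exp_nat_le (n := 8) (c := 7000) (by norm_num)
      push_cast at this
      linarith
    nlinarith

/-- **Ramaré 2001, Corollary 1 (even characters)**: for every even primitive Dirichlet character
`χ` of conductor `q > 1`, `|L(1,χ)| ≤ ½ log q`.  (The even conjunct of the tree's named fact
`Literature.NumberTheory.LFunctions.ramare2001_corollary1`; the constant `0` is Ramaré's, obtained
here for `log q ≥ 10` by his method with Vaaler's smoothing and below that from Louboutin's bound.)
[cite: Ramare2001LOneApproximateFormulae, Cor. 1 p. 247] -/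
theorem norm_LFunction_one_le_half_log_of_even (hχ : χ.IsPrimitive) (hχ1 : χ ≠ 1)
    (heven : χ.Even) : ‖χ.LFunction 1‖ ≤ Real.log q / 2 := by
  by_cases hq : (q:ℝ) ≤ 25000
  · exact norm_LFunction_one_le_half_log_of_le χ hχ hχ1 heven hq
  · rw [not_le] at hq
    refine norm_LFunction_one_le_half_log_of_log_ge χ hχ hχ1 heven ?_
    have hq0 : (0:ℝ) < q := by positivity
    rw [Real.le_log_iff_exp_le hq0]
    have := exp_nat_le (n := 10) (c := 25000) (by norm_num)
    push_cast at this
    linarith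

/-- The even conjunct of `ramare2001_corollary1`, in its quantified shape.
[cite: Ramare2001LOneApproximateFormulae, Cor. 1 p. 247] -/
theorem ramare2001_corollary1_even :
    ∀ (q : ℕ) [NeZero q] (χ : DirichletCharacter ℂ q), χ.IsPrimitive → χ ≠ 1 → χ.Even →
      ‖χ.LFunction 1‖ ≤ Real.log q / 2 :=
  fun _ _ χ hχ hχ1 heven => norm_LFunction_one_le_half_log_of_even χ hχ hχ1 heven

end Corollary

end Literature.NumberTheory.LFunctions.Ramare2001
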